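import Literature.NumberTheory.NumberFields.ClassGroupNormGalois
import Literature.NumberTheory.NumberFields.ClassGroupNormSurjective
import Mathlib.NumberTheory.NumberField.CMField
import HarnessLib

/-!
# Eigenfunctionals on the class group are killed by the relative class number
# (Lang, *Cyclotomic Fields I–II*, Ch. 3 §4, Thm. 4.4 and its proof; Washington §10.2)

Topic `NumberTheory/NumberFields`; namespace `Literature.NumberTheory.NumberFields`.  Theorem-only file (no
definition, no named fact, no `sorry`), unconditional.

THE OBSERVATION.  Let `L/K` be a Galois extension of number fields, `σ ∈ Gal(L/K)`, `p` a prime, and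
`μ : Cl_L → 𝔽_p` an additive map which is a `σ`-EIGENFUNCTIONAL with eigenvalue `a ≠ 1`:
`μ(σ•c) = a·μ(c)` for every class `c`.  For every class `c` the class `c·(σ•c)⁻¹` has trivial norm to
`K` (`N(σ•c) = N(c)`, Neukirch III (1.6)(iv) / the tree's `classGroupNorm_galois_smul`), i.e. lies in
`ker (N_{L/K} : Cl_L → Cl_K)`; so if `p ∤ #ker N_{L/K}` then `μ` vanishes on it, `(1 − a)·μ(c) = 0`, and
`μ = 0`.  This is the mechanism of Lang's proof of Thm. 4.4 (the composite `C_K → C_{K⁺} → C_K` is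
`c ↦ c^{1+τ}`, so the odd part of the class group is carried by the kernel of the norm, whose order is the
relative class number `h⁻ = h/h⁺`), isolated as a numerical criterion: **an eigenspace of `Cl_L ⊗ 𝔽_p` for a
non-trivial eigenvalue of `σ` is zero as soon as `p ∤ #ker N_{L/L^σ}`** — for a CM field `L` and `σ` the
complex conjugation, as soon as `p ∤ h⁻(L) = h(L)/h(L⁺)` (Lang Thm. 4.3/4.4: `N_{L/L⁺}` is onto, tree
`IsCMField.card_ker_classGroupNorm_mul_card`).  The relative class number of an imaginary abelian field is
given EXACTLY by the analytic class number formula (`h⁻ = Q w ∏_{χ odd} (−½ B_{1,χ})`, Washington Thm. 4.17),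
which is why this criterion is the one a census can certify without GRH where a full class group cannot be.

## Main results

* **`addMonoidHom_classGroup_eq_zero_of_eigenvalue_ne_one_of_not_dvd_card_ker`** — `L/K` Galois,
  `σ ∈ Gal(L/K)`, `p ∤ #ker N_{L/K}`, `μ : Cl_L →+ ZMod p` with `μ(σ•c) = a μ(c)`, `a ≠ 1` ⟹ `μ = 0`.
* `addMonoidHom_classGroup_eq_zero_of_smul_ne_one_of_not_dvd_card_ker` — the same with the eigen-relation
  written on integral ideals (`J = σ(I) ⟹ μ[J] = a • μ[I]`, `a : ℕ`, `a ≢ 1 (mod p)`), the shape used by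
  the tree's isotypic layer-zero doors (`FineSelmerReducibleIsotypicLayerZero*`).
* `IsCMField.card_ker_classGroupNorm_eq_div` — `#ker N_{K/K⁺} = h_K / h_{K⁺}` for a CM field `K`.
* **`IsCMField.addMonoidHom_classGroup_eq_zero_of_conj_eigenvalue_ne_one`** — CM field `K`, `p` prime with
  `p ∤ h_K / h_{K⁺}`: every additive `μ : Cl_K → ZMod p` with `μ(τ•c) = a μ(c)` for the complex conjugation
  `τ` and some `a ≠ 1` (e.g. `a = −1`, `p` odd: an ODD functional) vanishes.

## References

* S. Lang, *Cyclotomic Fields I and II*, GTM 121 (1990), Ch. 3 §4, Thm. 4.3, Thm. 4.4 and Corollary. [Lang1990]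
* L. C. Washington, *Introduction to Cyclotomic Fields*, 2nd ed. (1997), Thm. 4.17, §10.2 (Thm. 10.3), Thm. 10.1.
  [Washington1997]
* J. Neukirch, *Algebraic Number Theory* (1999), Ch. III §1 Prop. (1.6) (iv). [NeukirchANT1999]
-/

noncomputable section

open NumberField NumberField.IsCMField IsDedekindDomain
open scoped nonZeroDivisors

namespace Literature.NumberTheory.NumberFields

section General

variable (K L : Type) [Field K] [NumberField K] [Field L] [NumberField L] [Algebra K L] [IsGalois K L]

/-- A homomorphism from a finite group of order prime to `p` into `ZMod p` kills everything: for `d` in a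
subgroup `H` of a commutative group `G` with `p ∤ #H` and any additive `μ : G → ZMod p`, `μ(d) = 0`
(`#H · μ(d) = μ(d^{#H}) = 0` and `#H` is a unit mod `p`). [folklore] -/
private theorem addMonoidHom_apply_eq_zero_of_mem_of_not_dvd_card {G : Type*} [CommGroup G] {p : ℕ}
    [hp : Fact p.Prime] (H : Subgroup G) (hH : ¬ p ∣ Nat.card H) (μ : Additive G →+ ZMod p) {d : G}
    (hd : d ∈ H) : μ (Additive.ofMul d) = 0 := by
  have hpow : d ^ Nat.card H = 1 := by
    have h := (pow_card_eq_one' : (⟨d, hd⟩ : H) ^ Nat.card H = 1)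
    exact congrArg Subtype.val h
  have h1 : ((Nat.card H : ℕ) : ZMod p) * μ (Additive.ofMul d) = 0 := by
    rw [← nsmul_eq_mul, ← map_nsmul, ← ofMul_pow, hpow, ofMul_one, map_zero]
  have hn : ((Nat.card H : ℕ) : ZMod p) ≠ 0 := by
    rw [Ne, ZMod.natCast_eq_zero_iff]
    exact hH
  exact (mul_eq_zero.mp h1).resolve_left hn

/-- **Eigenfunctionals for a non-trivial eigenvalue are killed by the relative class number.**  Let `L/K` be a
Galois extension of number fields, `σ ∈ Gal(L/K)`, `p` a prime with `p ∤ #ker (N_{L/K} : Cl_L → Cl_K)`, and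
`μ : Cl_L → ZMod p` additive with `μ(σ • c) = a · μ(c)` for all classes `c` (`σ` acting through
`ClassGroup.mulEquiv (AmbiguousClass.intAut σ)`) and some `a ≠ 1`.  Then `μ = 0`.  Proof: `c · (σ•c)⁻¹ ∈ ker N`
since `N(σ•c) = N(c)`; `μ` vanishes there; so `(1 − a) μ(c) = 0`.  (Lang's proof of Thm. 4.4: the composite of
the norm and the injection is `c ↦ c^{1+τ}`.) [cite: Lang1990, Ch. 3 §4, Thm. 4.4 (proof)]
[cite: NeukirchANT1999, Ch. III §1 Prop. (1.6) (iv)] -/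
theorem addMonoidHom_classGroup_eq_zero_of_eigenvalue_ne_one_of_not_dvd_card_ker {p : ℕ} [hp : Fact p.Prime]
    (σ : L ≃ₐ[K] L) (hker : ¬ p ∣ Nat.card (classGroupNorm K L).ker)
    (μ : Additive (ClassGroup (𝓞 L)) →+ ZMod p) (a : ZMod p) (ha : a ≠ 1)
    (hμ : ∀ c : ClassGroup (𝓞 L),
      μ (Additive.ofMul (ClassGroup.mulEquiv (AmbiguousClass.intAut σ) c)) = a * μ (Additive.ofMul c)) :
    μ = 0 := by
  refine AddMonoidHom.ext fun x => ?_
  obtain ⟨c, rfl⟩ : ∃ c : ClassGroup (𝓞 L), Additive.ofMul c = x := ⟨Additive.toMul x, rfl⟩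
  have hmem : c * (ClassGroup.mulEquiv (AmbiguousClass.intAut σ) c)⁻¹ ∈ (classGroupNorm K L).ker := by
    rw [MonoidHom.mem_ker, map_mul, map_inv, classGroupNorm_galois_smul, mul_inv_cancel]
  have h0 := addMonoidHom_apply_eq_zero_of_mem_of_not_dvd_card _ hker μ hmem
  rw [ofMul_mul, ofMul_inv, map_add, map_neg, hμ, ← sub_eq_add_neg, ← one_sub_mul] at h0
  rw [AddMonoidHom.zero_apply]
  exact (mul_eq_zero.mp h0).resolve_left (sub_ne_zero.mpr (Ne.symm ha))

/-- **The same criterion with the eigen-relation on integral ideals** (the shape of the tree's isotypic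
layer-zero eigen-tests): if `μ[σ(I)] = a • μ[I]` for all non-zero integral ideals `I` of `L`, with `a : ℕ`,
`a ≢ 1 (mod p)`, and `p ∤ #ker N_{L/K}`, then `μ = 0`. [cite: Lang1990, Ch. 3 §4, Thm. 4.4 (proof)] -/
theorem addMonoidHom_classGroup_eq_zero_of_smul_ne_one_of_not_dvd_card_ker {p : ℕ} [hp : Fact p.Prime]
    (σ : L ≃ₐ[K] L) (hker : ¬ p ∣ Nat.card (classGroupNorm K L).ker)
    (μ : Additive (ClassGroup (𝓞 L)) →+ ZMod p) (a : ℕ) (ha : ¬ a ≡ 1 [MOD p])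
    (hμ : ∀ I J : (Ideal (𝓞 L))⁰,
      (J : Ideal (𝓞 L)) = (I : Ideal (𝓞 L)).map (AmbiguousClass.intAut σ : 𝓞 L →+* 𝓞 L) →
        μ (Additive.ofMul (ClassGroup.mk0 J)) = a • μ (Additive.ofMul (ClassGroup.mk0 I))) :
    μ = 0 := by
  classical
  refine addMonoidHom_classGroup_eq_zero_of_eigenvalue_ne_one_of_not_dvd_card_ker K L σ hker μ
    (a : ZMod p) ?_ ?_
  · intro h
    apply ha
    have h1 : ((a : ℕ) : ZMod p) = ((1 : ℕ) : ZMod p) := by rw [h, Nat.cast_one]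
    exact (ZMod.natCast_eq_natCast_iff a 1 p).mp h1
  · intro c
    obtain ⟨I, rfl⟩ := ClassGroup.mk0_surjective c
    rw [AmbiguousClass.mulEquiv_mk0, ← nsmul_eq_mul]
    exact hμ I ⟨_, AmbiguousClass.map_mem_nonZeroDivisors σ I⟩ rfl

end General

section CM

variable (K : Type) [Field K] [NumberField K] [IsCMField K]

/-- **`#ker N_{K/K⁺} = h_K / h_{K⁺}`** for a CM field `K`: the relative class number `h⁻` is the order of
the kernel of the (surjective) norm map on class groups (Lang Thm. 4.3/4.4 and Corollary; tree
`IsCMField.card_ker_classGroupNorm_mul_card`). [cite: Lang1990, Ch. 3 §4, Thm. 4.4 and its Corollary]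
[cite: Washington1997, Thm. 4.10 and Thm. 10.1] -/
theorem IsCMField.card_ker_classGroupNorm_eq_div :
    Nat.card (classGroupNorm (maximalRealSubfield K) K).ker =
      Fintype.card (ClassGroup (𝓞 K)) / Fintype.card (ClassGroup (𝓞 (maximalRealSubfield K))) := by
  have h := IsCMField.card_ker_classGroupNorm_mul_card K
  have hpos : 0 < Fintype.card (ClassGroup (𝓞 (maximalRealSubfield K))) := Fintype.card_pos
  rw [← h, Nat.mul_div_cancel _ hpos]

/-- **Odd (and more generally `τ`-eigen-, eigenvalue `≠ 1`) functionals on the class group of a CM field are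
killed by the relative class number.**  `K` a CM field with complex conjugation `τ = complexConj K`, `p` a
prime with `p ∤ h_K / h_{K⁺}` (`= h⁻ = #ker N_{K/K⁺}`): every additive `μ : Cl_K → ZMod p` with
`μ(τ • c) = a · μ(c)` for all `c` and some `a ≠ 1` — for `p` odd and `a = −1`, every ODD functional — is zero.
Equivalently: the eigenspaces of `τ` on `Cl_K ⊗ 𝔽_p` for eigenvalues `≠ 1` vanish when `p ∤ h⁻`; in particular
every `χ`-isotypic component of `Cl_K ⊗ 𝔽_p` for an ODD character `χ` of an abelian CM field.
[cite: Lang1990, Ch. 3 §4, Thm. 4.3, Thm. 4.4 and its Corollary] [cite: Washington1997, §10.2 (Thm. 10.3) and Thm. 4.17] -/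
theorem IsCMField.addMonoidHom_classGroup_eq_zero_of_conj_eigenvalue_ne_one {p : ℕ} [hp : Fact p.Prime]
    (h : ¬ p ∣ Fintype.card (ClassGroup (𝓞 K)) / Fintype.card (ClassGroup (𝓞 (maximalRealSubfield K))))
    (μ : Additive (ClassGroup (𝓞 K)) →+ ZMod p) (a : ZMod p) (ha : a ≠ 1)
    (hμ : ∀ c : ClassGroup (𝓞 K),
      μ (Additive.ofMul (ClassGroup.mulEquiv (AmbiguousClass.intAut (complexConj K)) c)) =
        a * μ (Additive.ofMul c)) :
    μ = 0 := by
  rw [← IsCMField.card_ker_classGroupNorm_eq_div K] at h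
  exact addMonoidHom_classGroup_eq_zero_of_eigenvalue_ne_one_of_not_dvd_card_ker
    (maximalRealSubfield K) K (complexConj K) h μ a ha hμ

/-- **Relative-norm form over an arbitrary base**: for a Galois extension `L/K` of number fields with
`N_{L/K} : Cl_L → Cl_K` SURJECTIVE (e.g. `L/K` of prime degree ramified at some place, tree
`ClassGroupNormSurjective.lean`) the criterion reads `p ∤ h_L / h_K` (`= #ker N_{L/K}`).
[cite: Lang1990, Ch. 3 §4, Thm. 4.4 and its Corollary] [cite: Washington1997, Thm. 10.1] -/
theorem addMonoidHom_classGroup_eq_zero_of_eigenvalue_ne_one_of_not_dvd_div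
    (F L : Type) [Field F] [NumberField F] [Field L] [NumberField L] [Algebra F L] [IsGalois F L]
    {p : ℕ} [hp : Fact p.Prime] (σ : L ≃ₐ[F] L) (hN : Function.Surjective (classGroupNorm F L))
    (h : ¬ p ∣ Fintype.card (ClassGroup (𝓞 L)) / Fintype.card (ClassGroup (𝓞 F)))
    (μ : Additive (ClassGroup (𝓞 L)) →+ ZMod p) (a : ZMod p) (ha : a ≠ 1)
    (hμ : ∀ c : ClassGroup (𝓞 L),
      μ (Additive.ofMul (ClassGroup.mulEquiv (AmbiguousClass.intAut σ) c)) = a * μ (Additive.ofMul c)) :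
    μ = 0 := by
  have hk := card_ker_classGroupNorm_mul_card F L hN
  have hpos : 0 < Fintype.card (ClassGroup (𝓞 F)) := Fintype.card_pos
  have hdiv : Nat.card (classGroupNorm F L).ker =
      Fintype.card (ClassGroup (𝓞 L)) / Fintype.card (ClassGroup (𝓞 F)) := by
    rw [← hk, Nat.mul_div_cancel _ hpos]
  rw [← hdiv] at h
  exact addMonoidHom_classGroup_eq_zero_of_eigenvalue_ne_one_of_not_dvd_card_ker F L σ h μ a ha hμ

end CM

end Literature.NumberTheory.NumberFields

end
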